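import Summits.AtomisticToContinuum.FouriersLaw.Theses.EmbeddedDrudeMourre
import Literature.MathematicalPhysics.KineticTheory.HarmonicChaosDecomposition
import HarnessLib

/-!
# The force window, part 0: the spectral measure of the free chaos Koopman group
(stub `stub_forceWindow` (KT) of line `gram-pencil-harmonic-chaos`, crux `EmbeddedDrudeMourre.DrudeDissolution`,
item stmt-AtomisticToContinuum-12593; `--supports` file, closes nothing)

WHAT. The normal-mode dictionary behind stub KT in the tree's chaos vocabulary
(`HarmonicChaosDecomposition.lean`): for a vector `Ψ` of the zero-wavenumber chaos space
`𝔉 = ⊕̂_s L²(Shell s)` supported on finitely many sectors `S`, the matrix coefficient of the free Koopman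
group `U⁰_t = exp(itΩ)` is the cosine transform of the EXPLICIT finite measure

  `m_Ψ = Σ_{s ∈ S} (Ω_s)_* (‖Ψ_s‖² σ_s)`,   `Re ⟪Ψ, U⁰_t Ψ⟫ = ∫ cos(xt) dm_Ψ(x)`

(`re_inner_chaosKoopman_eq_integral_cos`, registered helper; `re_inner_sectorKoopman`,
`integral_cos_map_withDensity` sector by sector), together with the bookkeeping of finite linear
combinations `Ψ = Σ_j c_j • wickVector ω₂ T (f j)` of Wick vectors of degree `N`: they vanish off the
sectors with `m + n = N` (`sum_smul_wickVector_eq_zero_of_ne`) and are represented a.e. by the continuous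
kernels `Σ_j c_j · wickKernel ω₂ T (f j) m n` (`coeFn_sum_smul_wickVector`).

HOW. `⟪Ψ, U⁰_tΨ⟫ = Σ_s ⟪Ψ_s, e^{itΩ_s}Ψ_s⟫` (`lp.inner_eq_tsum`, finitely supported), and on a
sector `⟪F, e^{itΩ}F⟫_{L²} = ∫ conj F · e^{itΩ} F dσ = ∫ e^{itΩ} ‖F‖² dσ` whose real part is
`∫ cos(tΩ) ‖F‖² dσ = ∫ cos(xt) d((Ω)_*(‖F‖²σ))(x)` (`integral_map`, `withDensity`). Linear combinations:
`lp.coeFn_sum/coeFn_smul`, `Lp.coeFn_finsetSum/coeFn_smul`, `coeFn_wickVector`, `wickKernel_of_ne`.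
Measure plumbing over Mathlib; no cited facts.
-/

noncomputable section

open MeasureTheory Filter Set Function Topology
open scoped InnerProductSpace ENNReal ComplexConjugate
open Literature.MathematicalPhysics.KineticTheory
open Literature.MathematicalPhysics.KineticTheory.HeatConduction
open Literature.MathematicalPhysics.KineticTheory.HeatConduction.HarmonicChaos
open Literature.MathematicalPhysics.KineticTheory.HeatConduction.PinnedChainKinetic

namespace Summit.AtomisticToContinuum.FouriersLaw.Theorems.DrudeDissolution.GramPencilHarmonicChaos

/-- An `L²` class has square-integrable norm. [folklore] -/
theorem integrable_norm_sq_sectorSpace {m n : ℕ} (F : SectorSpace m n) :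
    Integrable (fun κ => ‖F κ‖ ^ 2) (shellMeasure m n) :=
  (memLp_two_iff_integrable_sq_norm (Lp.aestronglyMeasurable F)).1 (Lp.memLp F)

/-- **Sector matrix coefficient of the free Koopman group**: on the sector `(m, n)`,
`Re ⟪F, exp(itΩ) F⟫_{L²(σ)} = ∫ cos(t Ω(κ)) ‖F(κ)‖² dσ(κ)`. [folklore] -/
theorem re_inner_sectorKoopman (ω₂ : ℝ) {m n : ℕ} (t : ℝ) (F : SectorSpace m n) :
    RCLike.re ⟪F, (sectorKoopman ω₂ m n t F : SectorSpace m n)⟫_ℂ =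
      ∫ κ, Real.cos (t * sectorPhase ω₂ κ) * ‖F κ‖ ^ 2 ∂(shellMeasure m n) := by
  rw [MeasureTheory.L2.inner_def, ← integral_re (MeasureTheory.L2.integrable_inner F _)]
  refine integral_congr_ae ?_
  filter_upwards [coeFn_sectorKoopman ω₂ t F] with κ hκ
  rw [hκ, RCLike.inner_apply', ← mul_assoc, mul_comm ((starRingEnd ℂ) (F κ)), mul_assoc,
    RCLike.conj_mul, ← RCLike.ofReal_pow, RCLike.re_mul_ofReal, RCLike.re_to_complex,
    Complex.exp_ofReal_mul_I_re]

/-- **Change of variables to the frequency axis**: `∫ cos(tΩ) ‖F‖² dσ = ∫ cos(xt) dm(x)` with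
`m = (Ω)_* (‖F‖² σ)` a finite measure on `ℝ`. [folklore] -/
theorem integral_cos_map_withDensity (ω₂ : ℝ) {m n : ℕ} (t : ℝ) (F : SectorSpace m n) :
    ∫ x, Real.cos (x * t) ∂(((shellMeasure m n).withDensity
        (fun κ => ENNReal.ofReal (‖F κ‖ ^ 2))).map (sectorPhase ω₂)) =
      ∫ κ, Real.cos (t * sectorPhase ω₂ κ) * ‖F κ‖ ^ 2 ∂(shellMeasure m n) := by
  rw [integral_map (measurable_sectorPhase ω₂ m n).aemeasurable
    (by fun_prop : Continuous fun x : ℝ => Real.cos (x * t)).aestronglyMeasurable]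
  have hmeas : AEMeasurable (fun κ => ENNReal.ofReal (‖F κ‖ ^ 2)) (shellMeasure m n) :=
    ENNReal.measurable_ofReal.comp_aemeasurable
      ((Lp.aestronglyMeasurable F).norm.aemeasurable.pow_const 2)
  rw [integral_withDensity_eq_integral_toReal_smul₀ hmeas
    (ae_of_all _ (fun κ => ENNReal.ofReal_lt_top))]
  refine integral_congr_ae (ae_of_all _ (fun κ => ?_))
  simp only [ENNReal.toReal_ofReal (sq_nonneg _), smul_eq_mul]
  rw [mul_comm (sectorPhase ω₂ κ) t]
  ring

/-- The sector contribution `(Ω_s)_* (‖F‖² σ_s)` is a finite measure (`F ∈ L²`). [folklore] -/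
theorem isFiniteMeasure_map_withDensity (ω₂ : ℝ) {m n : ℕ} (F : SectorSpace m n) :
    IsFiniteMeasure (((shellMeasure m n).withDensity
        (fun κ => ENNReal.ofReal (‖F κ‖ ^ 2))).map (sectorPhase ω₂)) := by
  haveI : IsFiniteMeasure ((shellMeasure m n).withDensity (fun κ => ENNReal.ofReal (‖F κ‖ ^ 2))) :=
    isFiniteMeasure_withDensity_ofReal (integrable_norm_sq_sectorSpace F).2
  infer_instance

/-- **Registered helper (stub K): the spectral measure of a finitely supported chaos vector under the
free Koopman group is the explicit sector sum `Σ_s (Ω_s)_* (‖Ψ_s‖² σ_s)`** — for every `t`,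
`Re ⟪Ψ, U⁰_t Ψ⟫_𝔉 = ∫ cos(xt) d(Σ_{s ∈ S} (Ω_s)_* (‖Ψ_s‖² σ_s))(x)` whenever `Ψ_s = 0` off the finite
set `S` of sector labels. [folklore] -/
theorem re_inner_chaosKoopman_eq_integral_cos : ∀ (ω₂ : ℝ) (Ψ : Literature.MathematicalPhysics.KineticTheory.HeatConduction.HarmonicChaos.ChaosSpace) (S : Finset Literature.MathematicalPhysics.KineticTheory.HeatConduction.HarmonicChaos.SectorIndex), (∀ s ∉ S, Ψ s = 0) → ∀ t : ℝ, RCLike.re (inner ℂ Ψ (Literature.MathematicalPhysics.KineticTheory.HeatConduction.HarmonicChaos.chaosKoopman ω₂ t Ψ : Literature.MathematicalPhysics.KineticTheory.HeatConduction.HarmonicChaos.ChaosSpace)) = ∫ x, Real.cos (x * t) ∂(∑ s ∈ S, (((Literature.MathematicalPhysics.KineticTheory.HeatConduction.HarmonicChaos.shellMeasure s.cr s.an).withDensity (fun κ => ENNReal.ofReal (‖Ψ s κ‖ ^ 2))).map (Literature.MathematicalPhysics.KineticTheory.HeatConduction.HarmonicChaos.sectorPhase ω₂))) := by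
  intro ω₂ Ψ S hS t
  rw [lp.inner_eq_tsum, tsum_eq_sum (s := S) (fun s hs => by rw [hS s hs]; simp), map_sum]
  rw [integral_finsetSum_measure]
  · refine Finset.sum_congr rfl (fun s _ => ?_)
    rw [chaosKoopman_apply, re_inner_sectorKoopman, integral_cos_map_withDensity]
  · intro s _
    haveI := isFiniteMeasure_map_withDensity ω₂ (Ψ s)
    refine (integrable_const (1 : ℝ)).mono'
      (by fun_prop : Continuous fun x : ℝ => Real.cos (x * t)).aestronglyMeasurable
      (ae_of_all _ (fun x => ?_))
    rw [Real.norm_eq_abs]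
    exact Real.abs_cos_le_one _

/-- The sector-sum spectral measure is finite. [folklore] -/
theorem isFiniteMeasure_sectorSum (ω₂ : ℝ) (Ψ : ChaosSpace) (S : Finset SectorIndex) :
    IsFiniteMeasure (∑ s ∈ S, (((shellMeasure s.cr s.an).withDensity
        (fun κ => ENNReal.ofReal (‖Ψ s κ‖ ^ 2))).map (sectorPhase ω₂))) := by
  haveI : ∀ s : SectorIndex, IsFiniteMeasure ((((shellMeasure s.cr s.an).withDensity
      (fun κ => ENNReal.ofReal (‖Ψ s κ‖ ^ 2))).map (sectorPhase ω₂))) :=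
    fun s => isFiniteMeasure_map_withDensity ω₂ (Ψ s)
  infer_instance

/-! ### Finite linear combinations of Wick vectors -/

/-- Components of a finite linear combination of chaos vectors: `(Σ_j c_j • Ψ_j) s = Σ_j c_j • Ψ_j s`.
[folklore] -/
theorem sum_smul_chaos_apply {J : ℕ} (c : Fin J → ℂ) (Ψ : Fin J → ChaosSpace) (s : SectorIndex) :
    (∑ j : Fin J, c j • Ψ j : ChaosSpace) s = ∑ j : Fin J, c j • Ψ j s := by
  rw [lp.coeFn_sum, Finset.sum_apply]
  refine Finset.sum_congr rfl fun j _ => ?_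
  rw [lp.coeFn_smul, Pi.smul_apply]

/-- A linear combination of Wick vectors of degree `N` vanishes in the sectors with `m + n ≠ N`.
[folklore] -/
theorem sum_smul_wickVector_eq_zero_of_ne (ω₂ T : ℝ) {N J : ℕ} (c : Fin J → ℂ)
    (f : Fin J → Fin N → TestFn) {s : SectorIndex} (hs : s.cr + s.an ≠ N) :
    (∑ j : Fin J, c j • wickVector ω₂ T (f j) : ChaosSpace) s = 0 := by
  rw [sum_smul_chaos_apply]
  refine Finset.sum_eq_zero fun j _ => ?_
  rw [wickVector_apply, wickKernel_of_ne ω₂ T (f j) hs, toL2C_zero, smul_zero]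

/-- For `ω₂ > 0` the sector components of a linear combination of Wick vectors are represented by the
corresponding combination of the (continuous) Wick kernels. [folklore] -/
theorem coeFn_sum_smul_wickVector {ω₂ : ℝ} (hω : 0 < ω₂) (T : ℝ) {N J : ℕ} (c : Fin J → ℂ)
    (f : Fin J → Fin N → TestFn) (s : SectorIndex) :
    ((∑ j : Fin J, c j • wickVector ω₂ T (f j) : ChaosSpace) s : Shell s.cr s.an → ℂ) =ᵐ[shellMeasure s.cr s.an]
      fun κ => ∑ j : Fin J, c j * wickKernel ω₂ T (f j) s.cr s.an κ := by
  rw [sum_smul_chaos_apply]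
  have h : ∀ j : Fin J, ((c j • wickVector ω₂ T (f j) s : SectorSpace s.cr s.an) : Shell s.cr s.an → ℂ)
      =ᵐ[shellMeasure s.cr s.an] fun κ => c j * wickKernel ω₂ T (f j) s.cr s.an κ := fun j => by
    filter_upwards [Lp.coeFn_smul (c j) (wickVector ω₂ T (f j) s : SectorSpace s.cr s.an),
      coeFn_wickVector hω T (f j) s] with κ h1 h2
    rw [h1, Pi.smul_apply, h2, smul_eq_mul]
  filter_upwards [Lp.coeFn_fun_finsetSum Finset.univ (fun j => (c j • wickVector ω₂ T (f j) s :
      SectorSpace s.cr s.an)), ae_all_iff.2 h] with κ h1 h2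
  rw [h1]
  exact Finset.sum_congr rfl fun j _ => h2 j

/-- The continuous kernel of a linear combination of Wick vectors gives the same weighted shell measure
as its `L²` class. [folklore] -/
theorem withDensity_sum_smul_wickVector {ω₂ : ℝ} (hω : 0 < ω₂) (T : ℝ) {N J : ℕ} (c : Fin J → ℂ)
    (f : Fin J → Fin N → TestFn) (s : SectorIndex) :
    (shellMeasure s.cr s.an).withDensity
        (fun κ => ENNReal.ofReal (‖(∑ j : Fin J, c j • wickVector ω₂ T (f j) : ChaosSpace) s κ‖ ^ 2)) =
      (shellMeasure s.cr s.an).withDensity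
        (fun κ => ENNReal.ofReal (‖∑ j : Fin J, c j * wickKernel ω₂ T (f j) s.cr s.an κ‖ ^ 2)) := by
  refine withDensity_congr_ae ?_
  filter_upwards [coeFn_sum_smul_wickVector hω T c f s] with κ hκ
  rw [hκ]

end Summit.AtomisticToContinuum.FouriersLaw.Theorems.DrudeDissolution.GramPencilHarmonicChaos

end
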